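import Summits.CriticalPhenomena.PercolationContinuityZ3.Theorems.Transplant.SkelFrmBParamsFaceFloorsPinSYA
import Summits.CriticalPhenomena.PercolationContinuityZ3.Theorems.Transplant.SkelFrmBParamsFaceFloorsLAdYA
import Summits.CriticalPhenomena.PercolationContinuityZ3.Theorems.Transplant.SkelFrmBParamsFaceOriginsYLA
import Summits.CriticalPhenomena.PercolationContinuityZ3.Theorems.Transplant.SkelFrmBParamsFaceOriginsXA
import Summits.CriticalPhenomena.PercolationContinuityZ3.Theorems.Transplant.SkelFrmBParamsFaceOriginsYA
import Summits.CriticalPhenomena.PercolationContinuityZ3.Theorems.Transplant.SkelFrmBParamsFramesF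
import Summits.CriticalPhenomena.PercolationContinuityZ3.Theorems.Transplant.SkelFrmBParamsFaceFloorsClrYF
import Summits.CriticalPhenomena.PercolationContinuityZ3.Theorems.Transplant.SkelFrmBParamsFaceFloorsClrYA
import Summits.CriticalPhenomena.PercolationContinuityZ3.Theorems.Transplant.SkelFrmBParamsFaceFloorsFAYA
import Summits.CriticalPhenomena.PercolationContinuityZ3.Theorems.Transplant.SkelFrmBParamsFaceFloorsFBYA
import Summits.CriticalPhenomena.PercolationContinuityZ3.Theorems.Transplant.SkelFrmBParamsFaceFloorsFTYA
import Summits.CriticalPhenomena.PercolationContinuityZ3.Theorems.Transplant.SkelFrmBParamsFaceFloorsLYA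
import Summits.CriticalPhenomena.PercolationContinuityZ3.Theorems.Transplant.SkelFrmBParamsFaceFloorsQYA
import Summits.CriticalPhenomena.PercolationContinuityZ3.Theorems.Transplant.SkelFrmBParamsFaceFloorsZPiYA
import Summits.CriticalPhenomena.PercolationContinuityZ3.Theorems.Transplant.SkelFrmBParamsFaceFloorsZYA
import Summits.CriticalPhenomena.PercolationContinuityZ3.Theorems.Transplant.SkelFrmBParamsFaceFloorsPinYA
import Summits.CriticalPhenomena.PercolationContinuityZ3.Theorems.Transplant.SkelFrmBParamsFaceCountsYA
import Summits.CriticalPhenomena.PercolationContinuityZ3.Theorems.Transplant.SkelFrmBParamsFaceCountsRangeYA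
import Summits.CriticalPhenomena.PercolationContinuityZ3.Theorems.Transplant.SkelFrmBParamsFaceCountsShiftYA
import Summits.CriticalPhenomena.PercolationContinuityZ3.Theorems.Transplant.SkelPhiFaceNumsYP2T
import Summits.CriticalPhenomena.PercolationContinuityZ3.Theorems.Transplant.SkelFrmBChoiceWindow
import Summits.CriticalPhenomena.PercolationContinuityZ3.Theorems.Transplant.PlanarSkeletonFrmDefs
import Summits.CriticalPhenomena.PercolationContinuityZ3.Theorems.Transplant.SkelPhiStepIDataNS
import Summits.CriticalPhenomena.PercolationContinuityZ3.Theorems.Transplant.SkelFrmBParamsFaceFloorsY2SA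
import Summits.CriticalPhenomena.PercolationContinuityZ3.Theorems.Transplant.SkelFrmBParamsFaceFloorsY2WA
import Summits.CriticalPhenomena.PercolationContinuityZ3.Theorems.Transplant.SkelFrmBParamsFaceFloorsYxD
import Summits.CriticalPhenomena.PercolationContinuityZ3.Theorems.Transplant.SkelFrmBParamsFaceFloorsYxF
import Summits.CriticalPhenomena.PercolationContinuityZ3.Theorems.Transplant.SkelFrmBParamsFaceFloorsLXA
import Summits.CriticalPhenomena.PercolationContinuityZ3.Theorems.Transplant.SkelFrmBParamsFaceFloorsX2WA
import Summits.CriticalPhenomena.PercolationContinuityZ3.Theorems.Transplant.SkelFrmBParamsFaceFloorsClrXA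
import HarnessLib
/-!
# N2 (frames-only node, OPEN) — (F) column, (R-49)(c2b) VALUE LAYER part E2: **THE TWO-REGIME SEED CLEARANCE OF THE SECOND RUN** (hp-8 g43; (R-49)(a)/(c) of record, p3-g18 14:51:34Z / 15:35:03Z)

`KS.clr₃_Yx`: the field `hclr₃` of `Skelφ.FloorsYx2V` at the node (x-face origin `yL := yLXFs σ`, junction `yT := yTYx …`, second-run window
`qB3XA R'0`, one-sided `σ = 1`): every region `k ≤ N_y` of the y′-run is clear of the seed box `M_u` about the kit centre —
* regions `k ≤ 5` by ABSCISSA: `b + σ·yT₀ ≥ N_x·n_L + nBF + k·v_L − (k+1)·R′ ≥ n_L + nBF − 6R′ > M_u` (`yTYx_zero`, `yLXFs_zero`, `N_x ≥ NX0 = 6`,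
  `|v_L| ≤ n_L`, `clearF`);
* regions `k ≥ 6` by LEVEL: `U·yBoxLoS k ≥ k·m − Err − U ≥ (k − 5)·m ≥ m` (`ySBox_env`, `ySBox_err_le600`) and `U·M_u + |lev(yT)| < m`, where
  `lev(yT) = Λ₁(yTX0 yL σ)` (strides are level-neutral), `|Λ₁(yTX0 yL σ) − Λ₁(yL)| ≤ n_L`, `Λ₁(yLXFs σ) = σ·(n_L·hBF − h_L·nBF) + n_L·⌊(ℓ_L+ℓBF)/2⌋`
  so `|lev(yT)| ≤ n_L·(10·S_F + ℓ_L/2 + 1)` (`|h_L| ≤ 10·n_L`, `S_F = nBF + ℓBF + |hBF|`), and `64·S_F ≤ M_L < ℓ_L`, `M_u + 2 ≤ R'0`, `22000·Kq·(R'0+2) ≤ ℓ_L`.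
NON-VACUITY: instantiated by the assembly at the node tuple. builds on p205010 (kernel theorem, internal audit signed; external expert review pending)
— nothing here uses p205010; NOTHING is claimed about the open node `SamePDropOfSkeletonFrm₁`.
Lane `prim-bschramm`, seat `prim-hp-8` (gen 43); helper file (`--supports stmt-CriticalPhenomena-4575 --as helper`).
[cite: KozmaNitzan2024, §4 Lemma 11–12 (pp. 21–25)] [cite: MartineauTassion2017, §4.3]
-/

noncomputable section

open scoped Classical

namespace Summit.CriticalPhenomena.PercolationContinuityZ3.Theorems.Transplant

namespace PlanarSkeletonFrm

namespace NegB

open Literature.Probability.Percolation Literature.Probability.LatticeModels SimpleGraph KNCells KNLevels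
open Literature.Probability.Percolation.KozmaNitzan.Cells (oth sgOf sgOf_sign stepVec_apply_fst)
open SkelConc (Consts)
open Skelφ (shearUnit shearUnit_pos yBoxLoS yBoxHiS ySLo ySHi yBnd yBndC xBoxB xSLo xSHi xBoxLoA xBoxHiA crossOffY crossOffX yPrmW xCoreB xCSLo xCSHi yBoxLoT yBoxHiT)
open Skelφ.StepI (DataN)
open ChainPlanar (BridgePrm)
open TwoAxis.Para (modulus)
open Neg

namespace KS

/-- **The level of the x-face origin**: `Λ₁(yLXFs σ) = σ·(n_L·hBF − h_L·nBF) + n_L·mhXFs`. [folklore] -/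
theorem Λ₁of_yLXFs (κ : Consts) {V : Type} [DecidableEq V] [Countable V] {G : SimpleGraph V} [G.LocallyFinite] (Φ : PlanarSkeletonFrm G) (t : V) (p : unitInterval) (D : Skelφ.StepI.DataNS V) (g : ℕ) (f : ℕ) (c mk : ℕ) (σ : ℤ) :
    Λ₁of κ Φ t p D g f (yLXFs κ Φ t p D c mk g f σ) =
      σ * ((nL κ Φ t p D g f : ℤ) * hBF κ Φ t p D c mk - hL κ Φ t p D g f * (nBF κ Φ t p D c mk : ℤ)) + (nL κ Φ t p D g f : ℤ) * mhXFs κ Φ t p D c mk g f := by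
  unfold Λ₁of yLXFs yLof
  rw [Skelφ.pt_zero, Skelφ.pt_one]
  ring

set_option maxHeartbeats 1000000 in
/-- **THE TWO-REGIME SEED CLEARANCE OF THE SECOND RUN** (`hclr₃` of `FloorsYx2V` at the node; see the module docstring). [cite: KozmaNitzan2024, §4 Lemma 11–12 (pp. 21–25)] -/
theorem clr₃_Yx (κ : Consts) {V : Type} [DecidableEq V] [Countable V] {G : SimpleGraph V} [G.LocallyFinite] (Φ : PlanarSkeletonFrm G) (t : V) (p : unitInterval) (D : Skelφ.StepI.DataNS V) (g : ℕ) (f : ℕ) (c mk : ℕ) (P : PCells2T) (hN : EqNumL κ Φ t p D g f) (hκ : (hL κ Φ t p D g f).natAbs ≤ 10 * nL κ Φ t p D g f)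
    (hℓ : 22000 * Neg.Kq κ * ((KS0.R'0 κ Φ t p D mk) + 2) ≤ ℓL κ Φ t p D g f) (hS64 : 64 * SF κ Φ t p D c mk ≤ ML κ Φ t p D g) (hc : NX0 ≤ c)
    (x : Site 2) (du : MDir) (hsg : sgOf du = 1) (z : Site 2) (bw : ℕ)
    (hNy : NrY κ Φ t p D g f P (yTYx κ Φ t p D g f P (yLXFs κ Φ t p D c mk g f (sgOf du)) x du z bw) x du z + 1 ≤ 600 * Neg.Kq κ) :
    ∀ k ≤ NrY κ Φ t p D g f P (yTYx κ Φ t p D g f P (yLXFs κ Φ t p D c mk g f (sgOf du)) x du z bw) x du z,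
      (∀ b : ℤ, min ((sgOf du) * yBoxLoT (nL κ Φ t p D g f) (vL κ Φ t p D g f) (KS0.R'0 κ Φ t p D mk) k) ((sgOf du) * yBoxHiT (nL κ Φ t p D g f) (vL κ Φ t p D g f) (KS0.R'0 κ Φ t p D mk) k) ≤ b →
        b ≤ max ((sgOf du) * yBoxLoT (nL κ Φ t p D g f) (vL κ Φ t p D g f) (KS0.R'0 κ Φ t p D mk) k) ((sgOf du) * yBoxHiT (nL κ Φ t p D g f) (vL κ Φ t p D g f) (KS0.R'0 κ Φ t p D mk) k) →
          ((Mu D : ℕ) : ℤ) < sgOf du * (b + (yTYx κ Φ t p D g f P (yLXFs κ Φ t p D c mk g f (sgOf du)) x du z bw) 0)) ∨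
      ((shearUnit (nL κ Φ t p D g f) (hL κ Φ t p D g f) : ℤ) * ((Mu D : ℕ) : ℤ) + |(nL κ Φ t p D g f : ℤ) * (yTYx κ Φ t p D g f P (yLXFs κ Φ t p D c mk g f (sgOf du)) x du z bw) 1 - hL κ Φ t p D g f * (yTYx κ Φ t p D g f P (yLXFs κ Φ t p D c mk g f (sgOf du)) x du z bw) 0| <
        (shearUnit (nL κ Φ t p D g f) (hL κ Φ t p D g f) : ℤ) * yBoxLoS (nL κ Φ t p D g f) (ℓL κ Φ t p D g f) (hL κ Φ t p D g f) (qB3XA κ Φ t p D g f (KS0.R'0 κ Φ t p D mk)) (KS0.R'0 κ Φ t p D mk) k) := by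
  intro k hk
  obtain ⟨hn1, hℓ1⟩ := one_le_of_eqNumL κ Φ t p D g f hN
  have hv := hN.v_le
  obtain ⟨hv1, hv2⟩ := abs_le.1 hv
  have hn : (1 : ℤ) ≤ (nL κ Φ t p D g f : ℤ) := by exact_mod_cast hn1
  have hR0 : (0 : ℤ) ≤ ((KS0.R'0 κ Φ t p D mk) : ℤ) := by positivity
  have hk0 : (0 : ℤ) ≤ (k : ℤ) := by positivity
  by_cases hk5 : k ≤ 5
  · -- the α-branch
    left
    intro b hb1 _
    rw [hsg] at hb1 ⊢
    simp only [one_mul] at hb1 ⊢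
    have hLoHi : yBoxLoT (nL κ Φ t p D g f) (vL κ Φ t p D g f) (KS0.R'0 κ Φ t p D mk) k ≤ yBoxHiT (nL κ Φ t p D g f) (vL κ Φ t p D g f) (KS0.R'0 κ Φ t p D mk) k := by
      unfold yBoxLoT yBoxHiT
      have h1 : (0 : ℤ) ≤ ((((nL κ Φ t p D g f : ℤ) + vL κ Φ t p D g f).toNat : ℕ) : ℤ) := by positivity
      have h2 : (0 : ℤ) ≤ ((((nL κ Φ t p D g f : ℤ) - vL κ Φ t p D g f).toNat : ℕ) : ℤ) := by positivity
      nlinarith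
    rw [min_eq_left hLoHi] at hb1
    have eLo : yBoxLoT (nL κ Φ t p D g f) (vL κ Φ t p D g f) (KS0.R'0 κ Φ t p D mk) k = (k : ℤ) * vL κ Φ t p D g f - ((nL κ Φ t p D g f : ℤ) + vL κ Φ t p D g f) - (k : ℤ) * (KS0.R'0 κ Φ t p D mk) - (KS0.R'0 κ Φ t p D mk) - (nL κ Φ t p D g f : ℤ) := by
      unfold yBoxLoT
      have e : ((((nL κ Φ t p D g f : ℤ) + vL κ Φ t p D g f).toNat : ℕ) : ℤ) = (nL κ Φ t p D g f : ℤ) + vL κ Φ t p D g f := Int.toNat_of_nonneg (by linarith)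
      rw [e]; ring
    have hyT := yTYx_zero κ Φ t p D g f P (yLXFs κ Φ t p D c mk g f (sgOf du)) x du z bw
    rw [yLXFs_zero κ Φ t p D c mk g f (sgOf_sign du), hsg, one_mul] at hyT
    have hNx6 : (6 : ℤ) ≤ (NxW κ Φ t p D g f P (yLXFs κ Φ t p D c mk g f 1) x du z bw : ℤ) := by
      have := NxW_ge κ Φ t p D g f P (yLXFs κ Φ t p D c mk g f 1) x du z bw; unfold NX0 at this; exact_mod_cast this
    have hNxn : 6 * (nL κ Φ t p D g f : ℤ) ≤ (NxW κ Φ t p D g f P (yLXFs κ Φ t p D c mk g f 1) x du z bw : ℤ) * (nL κ Φ t p D g f : ℤ) := mul_le_mul_of_nonneg_right hNx6 (by linarith)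
    have hkv : (k : ℤ) * (-(nL κ Φ t p D g f : ℤ)) ≤ (k : ℤ) * vL κ Φ t p D g f := mul_le_mul_of_nonneg_left hv1 hk0
    have hk5' : (k : ℤ) ≤ 5 := by exact_mod_cast hk5
    have hkR : (k : ℤ) * ((KS0.R'0 κ Φ t p D mk) : ℤ) ≤ 5 * ((KS0.R'0 κ Φ t p D mk) : ℤ) := mul_le_mul_of_nonneg_right hk5' hR0
    have hcl := clearF κ Φ t p D c mk
    have hc6 : (6 : ℤ) ≤ (c : ℤ) := by unfold NX0 at hc; exact_mod_cast hc
    have hcR : 7 * ((KS0.R'0 κ Φ t p D mk) : ℤ) ≤ ((c : ℤ) + 1) * ((KS0.R'0 κ Φ t p D mk) : ℤ) := mul_le_mul_of_nonneg_right (by linarith) hR0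
    nlinarith [hb1, eLo, hyT, hNxn, hkv, hkR, hcl, hcR, hk5']
  · -- the level branch
    right
    push Not at hk5
    have hk6 : (6 : ℤ) ≤ (k : ℤ) := by exact_mod_cast hk5
    have hkN : k + 1 ≤ 600 * Neg.Kq κ := by omega
    have hmm := Skelφ.NegPrm.modulus_vβOf hn1 (hL κ Φ t p D g f) (ℓL κ Φ t p D g f) (vL κ Φ t p D g f)
    have em : Skelφ.NegPrm.vβOf (nL κ Φ t p D g f) (hL κ Φ t p D g f) (ℓL κ Φ t p D g f) (vL κ Φ t p D g f) = vβL κ Φ t p D g f := rfl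
    rw [em] at hmm
    obtain ⟨hm1, hm2⟩ := hmm
    have hτ : (1 : ℤ) = 1 ∨ (1 : ℤ) = -1 := Or.inl rfl
    obtain ⟨hlb, -⟩ := ySBox_env κ Φ t p D g f hN hτ (qB3XA κ Φ t p D g f (KS0.R'0 κ Φ t p D mk)) (KS0.R'0 κ Φ t p D mk) k
    have herr := ySBox_err_le600 κ Φ t p D g f mk hN hκ hℓ hkN
    obtain ⟨hU1, hU2⟩ := clr_shearUnit_bounds κ Φ t p D g f hκ
    -- `U·yBoxLoS k ≥ U·ySLo 1 k ≥ k·m − Err − U ≥ (k−5)·m`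
    have hSLo : (shearUnit (nL κ Φ t p D g f) (hL κ Φ t p D g f) : ℤ) * ySLo (nL κ Φ t p D g f) (ℓL κ Φ t p D g f) (hL κ Φ t p D g f) (qB3XA κ Φ t p D g f (KS0.R'0 κ Φ t p D mk)) (KS0.R'0 κ Φ t p D mk) 1 k ≤ (shearUnit (nL κ Φ t p D g f) (hL κ Φ t p D g f) : ℤ) * yBoxLoS (nL κ Φ t p D g f) (ℓL κ Φ t p D g f) (hL κ Φ t p D g f) (qB3XA κ Φ t p D g f (KS0.R'0 κ Φ t p D mk)) (KS0.R'0 κ Φ t p D mk) k := by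
      apply mul_le_mul_of_nonneg_left _ (by linarith)
      unfold ySLo; rw [one_mul, one_mul]; exact min_le_left _ _
    -- the origin's level
    have hΛo := Λ₁of_yLXFs κ Φ t p D g f c mk (sgOf du)
    have hΛstep := clr_abs_Λ₁of_yTX0_sub κ Φ t p D g f hN (yLXFs κ Φ t p D c mk g f (sgOf du)) (sgOf du)
    have eT : (nL κ Φ t p D g f : ℤ) * (yTYx κ Φ t p D g f P (yLXFs κ Φ t p D c mk g f (sgOf du)) x du z bw) 1 - hL κ Φ t p D g f * (yTYx κ Φ t p D g f P (yLXFs κ Φ t p D c mk g f (sgOf du)) x du z bw) 0 = Λ₁of κ Φ t p D g f (yTX0 κ Φ t p D g f (yLXFs κ Φ t p D c mk g f (sgOf du)) (sgOf du)) := by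
      have : Λ₁of κ Φ t p D g f (yTYx κ Φ t p D g f P (yLXFs κ Φ t p D c mk g f (sgOf du)) x du z bw) = Λ₁of κ Φ t p D g f (yTX0 κ Φ t p D g f (yLXFs κ Φ t p D c mk g f (sgOf du)) (sgOf du)) := by
        unfold yTYx; rw [crossOffX_eq κ Φ t p D g f (yLXFs κ Φ t p D c mk g f (sgOf du)) (sgOf du) (sgOf du)]; exact Λ₁of_add_stride κ Φ t p D g f _ _
      rw [← this]; rfl
    rw [eT]
    -- sizes
    have hSe : ((SF κ Φ t p D c mk : ℕ) : ℤ) = (nBF κ Φ t p D c mk : ℤ) + (ℓBF κ Φ t p D c mk : ℤ) + |hBF κ Φ t p D c mk| := by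
      unfold SF; push_cast; ring
    have hS64' : 64 * ((SF κ Φ t p D c mk : ℕ) : ℤ) ≤ (ML κ Φ t p D g : ℤ) := by exact_mod_cast hS64
    have hMℓ := hN.ℓ_le
    have hmh0 : 0 ≤ mhXFs κ Φ t p D c mk g f := by unfold mhXFs; positivity
    have hmh2 : 2 * mhXFs κ Φ t p D c mk g f ≤ (ℓL κ Φ t p D g f : ℤ) + (ℓBF κ Φ t p D c mk : ℤ) := by unfold mhXFs; omega
    have h10 : |hL κ Φ t p D g f| ≤ 10 * (nL κ Φ t p D g f : ℤ) := by
      have : (((hL κ Φ t p D g f).natAbs : ℕ) : ℤ) ≤ 10 * (nL κ Φ t p D g f : ℤ) := by exact_mod_cast hκ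
      rwa [Int.natCast_natAbs] at this
    have hMu := Mu_add_two_le_R'0 κ Φ t p D mk
    have hMu' : ((Mu D : ℕ) : ℤ) + 2 ≤ ((KS0.R'0 κ Φ t p D mk) : ℤ) := by exact_mod_cast hMu
    have hℓ' : 22000 * (Neg.Kq κ : ℤ) * (((KS0.R'0 κ Φ t p D mk) : ℤ) + 2) ≤ (ℓL κ Φ t p D g f : ℤ) := by exact_mod_cast hℓ
    have hKq : (1 : ℤ) ≤ (Neg.Kq κ : ℤ) := by exact_mod_cast Neg.one_le_Kq κ
    have hnB0 : (0 : ℤ) ≤ (nBF κ Φ t p D c mk : ℤ) := by positivity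
    have hℓB0 : (0 : ℤ) ≤ (ℓBF κ Φ t p D c mk : ℤ) := by positivity
    -- |Λ₁(o)| ≤ n·|hBF| + |h|·nBF + n·mh
    have hσ1 : |sgOf du| = 1 := by rw [hsg]; norm_num
    have hΛabs : |Λ₁of κ Φ t p D g f (yLXFs κ Φ t p D c mk g f (sgOf du))| ≤ (nL κ Φ t p D g f : ℤ) * |hBF κ Φ t p D c mk| + |hL κ Φ t p D g f| * (nBF κ Φ t p D c mk : ℤ) + (nL κ Φ t p D g f : ℤ) * mhXFs κ Φ t p D c mk g f := by
      rw [hΛo]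
      calc |sgOf du * ((nL κ Φ t p D g f : ℤ) * hBF κ Φ t p D c mk - hL κ Φ t p D g f * (nBF κ Φ t p D c mk : ℤ)) + (nL κ Φ t p D g f : ℤ) * mhXFs κ Φ t p D c mk g f|
          ≤ |sgOf du * ((nL κ Φ t p D g f : ℤ) * hBF κ Φ t p D c mk - hL κ Φ t p D g f * (nBF κ Φ t p D c mk : ℤ))| + |(nL κ Φ t p D g f : ℤ) * mhXFs κ Φ t p D c mk g f| := abs_add_le _ _
        _ ≤ (nL κ Φ t p D g f : ℤ) * |hBF κ Φ t p D c mk| + |hL κ Φ t p D g f| * (nBF κ Φ t p D c mk : ℤ) + (nL κ Φ t p D g f : ℤ) * mhXFs κ Φ t p D c mk g f := by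
            rw [abs_mul, hσ1, one_mul, abs_mul, abs_of_nonneg (by positivity : (0:ℤ) ≤ (nL κ Φ t p D g f : ℤ)), abs_of_nonneg hmh0]
            have := abs_sub (↑(nL κ Φ t p D g f) * hBF κ Φ t p D c mk) (hL κ Φ t p D g f * ↑(nBF κ Φ t p D c mk))
            rw [abs_mul, abs_mul, abs_of_nonneg (by positivity : (0:ℤ) ≤ (nL κ Φ t p D g f : ℤ)), abs_of_nonneg hnB0] at this
            linarith
    have hΛT : |Λ₁of κ Φ t p D g f (yTX0 κ Φ t p D g f (yLXFs κ Φ t p D c mk g f (sgOf du)) (sgOf du))| ≤ |Λ₁of κ Φ t p D g f (yLXFs κ Φ t p D c mk g f (sgOf du))| + (nL κ Φ t p D g f : ℤ) := by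
      have := abs_sub_abs_le_abs_sub (Λ₁of κ Φ t p D g f (yTX0 κ Φ t p D g f (yLXFs κ Φ t p D c mk g f (sgOf du)) (sgOf du))) (Λ₁of κ Φ t p D g f (yLXFs κ Φ t p D c mk g f (sgOf du))); linarith
    -- linear assembly (atoms: n·M_u, n·S_F, n·ℓ, n·nBF, n·ℓBF, n·|hBF|, n·mh, U·M_u, k·m, U·ySLo, U·yBoxLoS)
    have hhn : |hL κ Φ t p D g f| * (nBF κ Φ t p D c mk : ℤ) ≤ 10 * ((nL κ Φ t p D g f : ℤ) * (nBF κ Φ t p D c mk : ℤ)) := by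
      have := mul_le_mul_of_nonneg_right h10 hnB0; linarith only [this, (by ring : 10 * (nL κ Φ t p D g f : ℤ) * (nBF κ Φ t p D c mk : ℤ) = 10 * ((nL κ Φ t p D g f : ℤ) * (nBF κ Φ t p D c mk : ℤ)))]
    have hm0 : 0 < modulus (nL κ Φ t p D g f) (hL κ Φ t p D g f) (vL κ Φ t p D g f) (vβL κ Φ t p D g f) := by
      have hℓ2 : (2 : ℤ) ≤ (ℓL κ Φ t p D g f : ℤ) := by
        have h1 := Neg.one_le_Kq κ
        have : 2 ≤ 22000 * Neg.Kq κ * (KS0.R'0 κ Φ t p D mk + 2) := by nlinarith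
        exact_mod_cast this.trans hℓ
      have : (1 : ℤ) ≤ (nL κ Φ t p D g f : ℤ) * (ℓL κ Φ t p D g f : ℤ) - (nL κ Φ t p D g f : ℤ) := by nlinarith only [hn, hℓ2]
      linarith only [this, hm1]
    have hkm : 6 * modulus (nL κ Φ t p D g f) (hL κ Φ t p D g f) (vL κ Φ t p D g f) (vβL κ Φ t p D g f) ≤ (k : ℤ) * modulus (nL κ Φ t p D g f) (hL κ Φ t p D g f) (vL κ Φ t p D g f) (vβL κ Φ t p D g f) := mul_le_mul_of_nonneg_right hk6 hm0.le
    have hlb' : (k : ℤ) * modulus (nL κ Φ t p D g f) (hL κ Φ t p D g f) (vL κ Φ t p D g f) (vβL κ Φ t p D g f) - (2 * (k : ℤ) * (shearUnit (nL κ Φ t p D g f) (hL κ Φ t p D g f) : ℤ) + (shearUnit (nL κ Φ t p D g f) (hL κ Φ t p D g f) : ℤ) * (qB3XA κ Φ t p D g f (KS0.R'0 κ Φ t p D mk) : ℕ) + (shearUnit (nL κ Φ t p D g f) (hL κ Φ t p D g f) : ℤ) * (((k : ℤ) + 1) * ((KS0.R'0 κ Φ t p D mk) : ℕ)) + 3 *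 ((nL κ Φ t p D g f : ℤ) * ℓL κ Φ t p D g f) + shearUnit (nL κ Φ t p D g f) (hL κ Φ t p D g f)) ≤
        (shearUnit (nL κ Φ t p D g f) (hL κ Φ t p D g f) : ℤ) * ySLo (nL κ Φ t p D g f) (ℓL κ Φ t p D g f) (hL κ Φ t p D g f) (qB3XA κ Φ t p D g f (KS0.R'0 κ Φ t p D mk)) (KS0.R'0 κ Φ t p D mk) 1 k := by simpa only [one_mul] using hlb
    have hLoS : modulus (nL κ Φ t p D g f) (hL κ Φ t p D g f) (vL κ Φ t p D g f) (vβL κ Φ t p D g f) + (shearUnit (nL κ Φ t p D g f) (hL κ Φ t p D g f) : ℤ) ≤ (shearUnit (nL κ Φ t p D g f) (hL κ Φ t p D g f) : ℤ) * yBoxLoS (nL κ Φ t p D g f) (ℓL κ Φ t p D g f) (hL κ Φ t p D g f) (qB3XA κ Φ t p D g f (KS0.R'0 κ Φ t p D mk)) (KS0.R'0 κ Φ t p D mk) k := by linarith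
    have hUMu : (shearUnit (nL κ Φ t p D g f) (hL κ Φ t p D g f) : ℤ) * ((Mu D : ℕ) : ℤ) ≤ 11 * ((nL κ Φ t p D g f : ℤ) * ((Mu D : ℕ) : ℤ)) := by
      have := mul_le_mul_of_nonneg_right hU2 (show (0:ℤ) ≤ ((Mu D : ℕ) : ℤ) by positivity); linarith only [this, (by ring : 11 * (nL κ Φ t p D g f : ℤ) * ((Mu D : ℕ) : ℤ) = 11 * ((nL κ Φ t p D g f : ℤ) * ((Mu D : ℕ) : ℤ)))]
    have hnS : (nL κ Φ t p D g f : ℤ) * ((SF κ Φ t p D c mk : ℕ) : ℤ) = (nL κ Φ t p D g f : ℤ) * (nBF κ Φ t p D c mk : ℤ) + (nL κ Φ t p D g f : ℤ) * (ℓBF κ Φ t p D c mk : ℤ) + (nL κ Φ t p D g f : ℤ) * |hBF κ Φ t p D c mk| := by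
      rw [hSe]; ring
    have hnB : 0 ≤ (nL κ Φ t p D g f : ℤ) * (nBF κ Φ t p D c mk : ℤ) := mul_nonneg (by linarith) hnB0
    have hnL' : 0 ≤ (nL κ Φ t p D g f : ℤ) * (ℓBF κ Φ t p D c mk : ℤ) := mul_nonneg (by linarith) hℓB0
    have hnH : 0 ≤ (nL κ Φ t p D g f : ℤ) * |hBF κ Φ t p D c mk| := mul_nonneg (by linarith) (abs_nonneg _)
    have hnmh : 2 * ((nL κ Φ t p D g f : ℤ) * mhXFs κ Φ t p D c mk g f) ≤ (nL κ Φ t p D g f : ℤ) * (ℓL κ Φ t p D g f : ℤ) + (nL κ Φ t p D g f : ℤ) * (ℓBF κ Φ t p D c mk : ℤ) := by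
      have := mul_le_mul_of_nonneg_left hmh2 (show (0:ℤ) ≤ (nL κ Φ t p D g f : ℤ) by linarith); linarith only [this, (by ring : (nL κ Φ t p D g f : ℤ) * (2 * mhXFs κ Φ t p D c mk g f) = 2 * ((nL κ Φ t p D g f : ℤ) * mhXFs κ Φ t p D c mk g f)), (by ring : (nL κ Φ t p D g f : ℤ) * ((ℓL κ Φ t p D g f : ℤ) + (ℓBF κ Φ t p D c mk : ℤ)) = (nL κ Φ t p D g f : ℤ) * (ℓL κ Φ t p D g f : ℤ) + (nL κ Φ t p D g f : ℤ) * (ℓBF κ Φ t p D c mk : ℤ))]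
    have hΛo2 : 2 * |Λ₁of κ Φ t p D g f (yLXFs κ Φ t p D c mk g f (sgOf du))| ≤ 20 * ((nL κ Φ t p D g f : ℤ) * ((SF κ Φ t p D c mk : ℕ) : ℤ)) + (nL κ Φ t p D g f : ℤ) * (ℓL κ Φ t p D g f : ℤ) := by
      linarith only [hΛabs, hhn, hnmh, hnS, hnB, hnL', hnH]
    -- the unit inequality `22·M_u + 20·S_F + 4 ≤ ℓ_L`, times `n_L`
    have hKR : (((KS0.R'0 κ Φ t p D mk) : ℤ) + 2) ≤ (Neg.Kq κ : ℤ) * (((KS0.R'0 κ Φ t p D mk) : ℤ) + 2) := le_mul_of_one_le_left (by linarith) hKq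
    have hunit : 22 * ((Mu D : ℕ) : ℤ) + 20 * ((SF κ Φ t p D c mk : ℕ) : ℤ) + 4 ≤ (ℓL κ Φ t p D g f : ℤ) := by
      have e22 : 22000 * (Neg.Kq κ : ℤ) * (((KS0.R'0 κ Φ t p D mk) : ℤ) + 2) = 22000 * ((Neg.Kq κ : ℤ) * (((KS0.R'0 κ Φ t p D mk) : ℤ) + 2)) := by ring
      rw [e22] at hℓ'
      linarith only [hMu', hS64', hMℓ, hℓ', hKR, hR0]
    have hunit' : 22 * ((nL κ Φ t p D g f : ℤ) * ((Mu D : ℕ) : ℤ)) + 20 * ((nL κ Φ t p D g f : ℤ) * ((SF κ Φ t p D c mk : ℕ) : ℤ)) + 4 * (nL κ Φ t p D g f : ℤ) ≤ (nL κ Φ t p D g f : ℤ) * (ℓL κ Φ t p D g f : ℤ) := by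
      have h := mul_le_mul_of_nonneg_left hunit (show (0 : ℤ) ≤ (nL κ Φ t p D g f : ℤ) by linarith)
      have e : (nL κ Φ t p D g f : ℤ) * (22 * ((Mu D : ℕ) : ℤ) + 20 * ((SF κ Φ t p D c mk : ℕ) : ℤ) + 4) =
          22 * ((nL κ Φ t p D g f : ℤ) * ((Mu D : ℕ) : ℤ)) + 20 * ((nL κ Φ t p D g f : ℤ) * ((SF κ Φ t p D c mk : ℕ) : ℤ)) + 4 * (nL κ Φ t p D g f : ℤ) := by ring
      linarith only [h, e]
    have hU1 : (1 : ℤ) ≤ (shearUnit (nL κ Φ t p D g f) (hL κ Φ t p D g f) : ℤ) := by linarith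
    linarith only [hLoS, hUMu, hΛT, hΛo2, hunit', hm1, hU1, hn]

end KS

end NegB

end PlanarSkeletonFrm

end Summit.CriticalPhenomena.PercolationContinuityZ3.Theorems.Transplant

end
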